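import Literature.AlgebraicGeometry.HodgeTheory.GAGADimensionCharts
import Literature.AlgebraicGeometry.HodgeTheory.GAGADimensionAlgebra
import Literature.NumberTheory.Transcendental.AnalytificationChartsProofs
import Literature.RingTheory.Smooth.PointDerivationLift
import Mathlib.LinearAlgebra.FiniteDimensional.Lemmas
import Mathlib.AlgebraicGeometry.Morphisms.Smooth
import HarnessLib

/-!
# A smooth morphism of smooth `ℂ`-schemes is a submersion on complex points (in algebraic charts)

Topic `Literature/AlgebraicGeometry/Motives`. Let `f : X ⟶ Y` be a morphism of `ℂ`-schemes with
`f` smooth (Mathlib `AlgebraicGeometry.Smooth`), and read the induced map of complex points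
`f(ℂ) : X(ℂ) → Y(ℂ)` in *algebraic charts* `e_X` at `P` and `e_Y` at `Q = f(P)` (charts of the
strong topology with regular coordinate functions in which all regular functions are holomorphic:
Serre, GAGA §2 n°5 Prop. 2; the tree's `Literature.NumberTheory.Transcendental.exists_algebraicChart`).
If `X(ℂ)` has the algebraic embedding dimension at `P` (local coordinates `t₁, …, tₙ` spanning
`𝔪_P` modulo `𝔪_P²` on an affine open `U ∋ P` over which `f` maps into the affine open carrying the
coordinates of `e_Y`), then **the differential of `e_Y ∘ f(ℂ) ∘ e_X⁻¹` at `e_X P` is onto**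
(`Literature.AlgebraicGeometry.Motives.surjective_fderiv_chart_map`). This is the analytic content of
SGA1 XII Prop. 3.1 (iv) («`f` lisse ⇔ `f^an` lisse», a smooth analytic morphism being a submersion
of complex manifolds), the input of Ehresmann's theorem for smooth proper families
(`Literature.AlgebraicGeometry.Motives.Voisin2002_tubeRestrict_isIso`).

Proof (tangent vectors as point derivations):

* `exists_eq_fderiv_chart_of_pointDerivation` — at a point with local coordinates `tᵢ` modulo
  `𝔪²`, every point derivation `D` of `Γ(X, U)` at `P` killing the scalars is *analytic*:
  `D(a) = d(a ∘ e_X⁻¹)(v)` for a unique tangent vector `v ∈ ℂⁿ` (the `dtᵢ` are a basis of the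
  cotangent space, the tree's `GAGADimension.linearIndependent_fderiv_chart`; solve `dtᵢ(v) = D(tᵢ)`
  and compare on `𝔪 = ∑ ℂ tᵢ + 𝔪²`, both sides killing `𝔪²` and the scalars);
* `surjective_fderiv_chart_map` — given `w ∈ ℂᵐ`, the point derivation `a ↦ d(a ∘ e_Y⁻¹)(w)` of
  `Γ(Y, V)` at `Q` extends along the formally smooth ring map `Γ(Y, V) → Γ(X, U)` (Mathlib
  `Smooth.smooth_appLE`; the tree's `Literature.RingTheory.Smooth.exists_pointDerivation_comp_eq`,
  Stacks 00TI) to a point derivation of `Γ(X, U)` at `P`, which is `d(· ∘ e_X⁻¹)(v)` for some `v`;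
  evaluating on the pulled-back coordinates `f^* u_j` of `e_Y` (whose read-off in `e_X` is the
  `j`-th component of the chart expression of `f(ℂ)`, by `AlgPoints.evalOrZero_map`) gives
  `d(e_Y ∘ f(ℂ) ∘ e_X⁻¹)(v) = w`.

Everything is proved; no named facts.

## References

* A. Grothendieck, M. Raynaud, *SGA 1*, Exp. XII, Prop. 3.1 (iv). [SGA1]
* J.-P. Serre, *Géométrie algébrique et géométrie analytique*, Ann. Inst. Fourier 6 (1956), §2 n°5
  Prop. 2, n°6 Cor. 2. [SerreGAGA1956]
* The Stacks Project, Tag 00TI. [StacksProject]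
-/

noncomputable section

open CategoryTheory AlgebraicGeometry Filter Topology
open scoped ContDiff
open Literature.AlgebraicGeometry.Motives.AlgPoints (evalOrZero evalOrZero_of_mem evalOrZero_of_not_mem)
open Literature.AlgebraicGeometry.HodgeTheory.GAGADimension

namespace Literature.AlgebraicGeometry.Motives

variable {X Y : SchemeOver ℂ} {n m : ℕ}

/-! ### Point derivations at a point with local coordinates are analytic -/

section Analytic

variable (e : OpenPartialHomeomorph (ComplexPoints X) (Fin n → ℂ)) {P : ComplexPoints X}
  (hP : P ∈ e.source)
  (hol : ∀ (U : X.left.affineOpens) (s : Γ(X.left, ↑U)),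
    ContDiffOn ℂ ω (evalOrZero ↑U s ∘ e.symm)
      (e.target ∩ e.symm ⁻¹' {Q | Q.pt ∈ (↑U : X.left.Opens)}))

/-- The space of `ℂ`-linear continuous functionals on `ℂⁿ` has dimension `n`. [folklore] -/
theorem finrank_dual_pi (n : ℕ) : Module.finrank ℂ ((Fin n → ℂ) →L[ℂ] ℂ) = n := by
  rw [← LinearEquiv.finrank_eq (LinearMap.toContinuousLinearMap :
      ((Fin n → ℂ) →ₗ[ℂ] ℂ) ≃ₗ[ℂ] (Fin n → ℂ) →L[ℂ] ℂ),
    Module.finrank_linearMap_self, Module.finrank_fin_fun]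

include hP hol in
/-- **Point derivations are tangent vectors.** Let `e` be an algebraic chart at `P` (regular
coordinates `alg`, regular functions holomorphic `hol`) and let `t₁, …, tₙ ∈ Γ(X, U)` span
`𝔪 = ker(evaluation at P)` modulo `𝔪²` over `ℂ`. Then every additive map `D : Γ(X, U) → ℂ` with the
Leibniz rule at `P` and vanishing on the scalars is the directional derivative in the chart along
one vector `v ∈ ℂⁿ`: `D(a) = d(a ∘ e⁻¹)_{e P}(v)` for all `a`. (Serre: at a simple point the analytic
and algebraic Zariski tangent spaces agree, GAGA §2 n°6 Cor. 2.)
[cite: SerreGAGA1956, §2 n°6 Cor. 2 (with §1 n°4)] -/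
theorem exists_eq_fderiv_chart_of_pointDerivation (U : X.left.affineOpens)
    (hU : P.pt ∈ (↑U : X.left.Opens)) (t : Fin n → Γ(X.left, ↑U))
    (htspan : ∀ a ∈ RingHom.ker (P.evalRingHom ↑U hU), ∃ coef : Fin n → ℂ,
      a - ∑ i, SchemeOver.scalarRingHom X ↑U (coef i) * t i ∈
        RingHom.ker (P.evalRingHom ↑U hU) ^ 2)
    (alg : ∃ (U₁ : X.left.affineOpens) (x : Fin n → Γ(X.left, ↑U₁)),
      e.source ⊆ {Q | Q.pt ∈ (↑U₁ : X.left.Opens)} ∧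
        ∀ Q ∈ e.source, ∀ i, e Q i = evalOrZero ↑U₁ (x i) Q)
    (D : Γ(X.left, ↑U) →+ ℂ)
    (hD : ∀ a b, D (a * b) = P.eval ↑U hU a * D b + P.eval ↑U hU b * D a)
    (hDc : ∀ c : ℂ, D (SchemeOver.scalarRingHom X ↑U c) = 0) :
    ∃ v : Fin n → ℂ, ∀ a, D a = fderiv ℂ (evalOrZero ↑U a ∘ e.symm) (e P) v := by
  classical
  set dt : Fin n → (Fin n → ℂ) →L[ℂ] ℂ := fun i => fderiv ℂ (evalOrZero ↑U (t i) ∘ e.symm) (e P)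
    with hdt
  have hli : LinearIndependent ℂ dt := linearIndependent_fderiv_chart e hP hol U hU t htspan alg
  have hspan : Submodule.span ℂ (Set.range dt) = ⊤ :=
    hli.span_eq_top_of_card_eq_finrank' (by rw [Fintype.card_fin, finrank_dual_pi])
  -- a vector killed by all `dtᵢ` is zero
  have hsep : ∀ v : Fin n → ℂ, (∀ i, dt i v = 0) → v = 0 := fun v hv => by
    have key : ∀ μ ∈ Submodule.span ℂ (Set.range dt), μ v = 0 := fun μ hμ => by
      refine Submodule.span_induction ?_ ?_ ?_ ?_ hμ
      · rintro _ ⟨i, rfl⟩; exact hv i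
      · simp
      · intro x y _ _ hx hy; simp [hx, hy]
      · intro c x _ hx; simp [hx]
    funext k
    have h := key (ContinuousLinearMap.proj k) (hspan ▸ Submodule.mem_top)
    simpa using h
  -- solve `dtᵢ(v) = D(tᵢ)`
  let Φ : (Fin n → ℂ) →ₗ[ℂ] (Fin n → ℂ) := LinearMap.pi fun i => (dt i).toLinearMap
  have hΦ : ∀ v i, Φ v i = dt i v := fun v i => rfl
  have hΦinj : Function.Injective Φ := fun v w h => by
    refine sub_eq_zero.1 (hsep _ fun i => ?_)
    have hi := congr_fun h i
    rw [hΦ, hΦ] at hi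
    rw [map_sub, hi, sub_self]
  obtain ⟨v, hv⟩ := LinearMap.surjective_of_injective hΦinj (fun i => D (t i))
  have hvi : ∀ i, dt i v = D (t i) := fun i => by rw [← hΦ, hv]
  refine ⟨v, fun a => ?_⟩
  -- `D` is `ℂ`-linear and kills `𝔪²`
  have hevκ : ∀ c, P.eval ↑U hU (SchemeOver.scalarRingHom X ↑U c) = c := fun c => by
    rw [AlgPoints.eval_scalarRingHom]; rfl
  have hDsmul : ∀ (c : ℂ) (s : Γ(X.left, ↑U)), D (SchemeOver.scalarRingHom X ↑U c * s) = c * D s :=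
    fun c s => by rw [hD, hevκ, hDc, mul_zero, add_zero]
  have hDsq : ∀ q ∈ RingHom.ker (P.evalRingHom ↑U hU) ^ 2, D q = 0 := fun q hq => by
    rw [pow_two] at hq
    refine Submodule.mul_induction_on hq (fun s hs s' hs' => ?_) (fun x y hx hy => ?_)
    · rw [RingHom.mem_ker, AlgPoints.evalRingHom_apply] at hs hs'
      rw [hD, hs, hs', zero_mul, zero_mul, add_zero]
    · rw [map_add, hx, hy, add_zero]
  -- decompose `a = (a - a(P)) + a(P)` and `a - a(P) = q + ∑ cᵢ tᵢ`, `q ∈ 𝔪²`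
  have ha' : a - SchemeOver.scalarRingHom X ↑U (P.eval ↑U hU a) ∈
      RingHom.ker (P.evalRingHom ↑U hU) := by
    rw [RingHom.mem_ker, map_sub, AlgPoints.evalRingHom_apply, AlgPoints.evalRingHom_apply, hevκ,
      sub_self]
  obtain ⟨coef, hcoef⟩ := htspan _ ha'
  set q := a - SchemeOver.scalarRingHom X ↑U (P.eval ↑U hU a) -
    ∑ i, SchemeOver.scalarRingHom X ↑U (coef i) * t i with hq
  have hdecomp : a = q + ∑ i, SchemeOver.scalarRingHom X ↑U (coef i) * t i +
      SchemeOver.scalarRingHom X ↑U (P.eval ↑U hU a) := by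
    rw [hq]; ring
  -- left-hand side
  have hL : D a = ∑ i, coef i * D (t i) := by
    rw [hdecomp, map_add, map_add, hDc, add_zero, hDsq q hcoef, zero_add, map_sum]
    exact Finset.sum_congr rfl fun i _ => hDsmul _ _
  -- right-hand side
  have hR : fderiv ℂ (evalOrZero ↑U a ∘ e.symm) (e P) v = ∑ i, coef i * D (t i) := by
    conv_lhs => rw [hdecomp]
    rw [fderiv_chart_add e hP hol U hU, fderiv_chart_add e hP hol U hU,
      fderiv_chart_scalarRingHom e hP U hU, add_zero, fderiv_chart_eq_zero_of_mem_sq e hP hol U hU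
      hcoef, zero_add, fderiv_chart_sum e hP hol U hU, _root_.sum_apply]
    refine Finset.sum_congr rfl fun i _ => ?_
    rw [fderiv_chart_smul e hP hol U hU, _root_.smul_apply, hvi, smul_eq_mul]
  rw [hL, hR]

end Analytic


/-! ### Local coordinates modulo `𝔪²` at a complex point of a smooth `ℂ`-scheme -/

/-- **Local coordinates at a complex point, inside a prescribed open set.** Let `X` be smooth of
relative dimension `n` over `ℂ`, `P ∈ X(ℂ)` and `W ∋ P` open. Then there are an affine open
`U ∋ P` with `U ⊆ W` and `t₁, …, tₙ ∈ Γ(X, U)` spanning `𝔪 = ker (evaluation at P)` modulo `𝔪²`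
over `ℂ`: a standard smooth affine neighbourhood (the tree's
`AlgPoints.exists_isStandardSmoothOfRelativeDimension_scalarRingHom`) shrunk to a basic open inside
`W` (standard smoothness is kept by localisation), whose local ring at the `ℂ`-rational maximal
ideal `𝔪` is regular of dimension `n` (Görtz–Wedhorn I Lemma 6.26; the tree's
`isRegularLocalRing_of_isStandardSmoothOfRelativeDimension`,
`height_eq_of_isStandardSmoothOfRelativeDimension`), so that `n` local parameters span `𝔪/𝔪²`
(`GAGADimension.exists_sub_sum_smul_mem_sq`). [cite: GortzWedhorn2020, Lemma 6.26] -/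
theorem exists_localCoordinates_le (n : ℕ) [SmoothOfRelativeDimension n X.hom]
    (P : ComplexPoints X) (W : X.left.Opens) (hPW : P.pt ∈ W) :
    ∃ (U : X.left.affineOpens) (hPU : P.pt ∈ (↑U : X.left.Opens)) (_ : (↑U : X.left.Opens) ≤ W)
      (t : Fin n → Γ(X.left, ↑U)),
      ∀ a ∈ RingHom.ker (P.evalRingHom ↑U hPU), ∃ coef : Fin n → ℂ,
        a - ∑ i, SchemeOver.scalarRingHom X ↑U (coef i) * t i ∈
          RingHom.ker (P.evalRingHom ↑U hPU) ^ 2 := by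
  classical
  obtain ⟨V, hV, hPV, hsm⟩ := AlgPoints.exists_isStandardSmoothOfRelativeDimension_scalarRingHom n P
  -- shrink to a basic open `D(h) ⊆ W`
  obtain ⟨h, hle, hPh⟩ := hV.exists_basicOpen_le ⟨P.pt, hPW⟩ hPV
  set U : X.left.Opens := X.left.basicOpen h with hUdef
  have hU : IsAffineOpen U := hV.basicOpen h
  haveI : IsLocalization.Away h Γ(X.left, U) := hV.isLocalization_basicOpen h
  -- `Γ(X, D(h))` is standard smooth of relative dimension `n` over the scalars
  have h0 : (algebraMap Γ(X.left, V) Γ(X.left, U)).IsStandardSmoothOfRelativeDimension 0 :=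
    RingHom.IsStandardSmoothOfRelativeDimension.algebraMap_isLocalizationAway h
  have hcomp : (algebraMap Γ(X.left, V) Γ(X.left, U)).comp (SchemeOver.scalarRingHom X V) =
      SchemeOver.scalarRingHom X U := by
    refine RingHom.ext fun c => ?_
    rw [RingHom.comp_apply, SchemeOver.scalarRingHom_apply, SchemeOver.scalarRingHom_apply]
    change (X.hom.appLE ⊤ V le_top ≫ X.left.presheaf.map (homOfLE (X.left.basicOpen_le h)).op) _ = _
    rw [Scheme.Hom.appLE_map]
  have hsmU : (SchemeOver.scalarRingHom X U).IsStandardSmoothOfRelativeDimension n := by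
    have := RingHom.IsStandardSmoothOfRelativeDimension.comp h0 hsm
    rw [hcomp, Nat.zero_add] at this
    exact this
  letI : Algebra ℂ Γ(X.left, U) := (SchemeOver.scalarRingHom X U).toAlgebra
  haveI : Algebra.IsStandardSmoothOfRelativeDimension n ℂ Γ(X.left, U) := hsmU
  haveI : Algebra.IsStandardSmooth ℂ Γ(X.left, U) :=
    Algebra.IsStandardSmoothOfRelativeDimension.isStandardSmooth n
  haveI : Algebra.FiniteType ℂ Γ(X.left, U) := inferInstance
  haveI : IsNoetherianRing Γ(X.left, U) := Algebra.FiniteType.isNoetherianRing ℂ _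
  have hPU : P.pt ∈ U := hPh
  -- the `ℂ`-rational maximal ideal of `P`
  set 𝔪 := RingHom.ker (P.evalRingHom U hPU) with h𝔪
  have hsurj : Function.Surjective (P.evalRingHom U hPU) := fun c =>
    ⟨SchemeOver.scalarRingHom X U c, by rw [AlgPoints.evalRingHom_apply, AlgPoints.eval_scalarRingHom]; rfl⟩
  haveI h𝔪max : 𝔪.IsMaximal := RingHom.ker_isMaximal_of_surjective _ hsurj
  haveI := Literature.AlgebraicGeometry.Motives.isRegularLocalRing_of_isStandardSmoothOfRelativeDimension
    ℂ n 𝔪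
  have hdim : ringKrullDim (Localization.AtPrime 𝔪) = n := by
    rw [IsLocalization.AtPrime.ringKrullDim_eq_height 𝔪,
      Literature.AlgebraicGeometry.Motives.height_eq_of_isStandardSmoothOfRelativeDimension ℂ n 𝔪]
    rfl
  let ψ : Γ(X.left, U) →ₐ[ℂ] ℂ :=
    { P.evalRingHom U hPU with commutes' := fun c => AlgPoints.eval_scalarRingHom P hPU c }
  have hψ : ∀ a, ψ a = 0 ↔ a ∈ 𝔪 := fun a => by rw [h𝔪, RingHom.mem_ker]; rfl
  obtain ⟨t, -, htspan⟩ := exists_sub_sum_smul_mem_sq ℂ 𝔪 hdim ψ hψ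
  refine ⟨⟨U, hU⟩, hPU, hle, t, fun a ha => ?_⟩
  obtain ⟨coef, hcoef⟩ := htspan a ha
  refine ⟨coef, ?_⟩
  simp only [Algebra.smul_def] at hcoef
  exact hcoef

/-! ### The differential of `f(ℂ)` in algebraic charts is onto -/

/-- The scalars of `Γ(X, U)` are the pull-backs of the scalars of `Γ(Y, V)` along `f` (both come
from `Γ(Spec ℂ, 𝒪) = ℂ`; `X → Spec ℂ` factors through `f`). [folklore] -/
theorem scalarRingHom_eq_appLE (f : X ⟶ Y) {V : Y.left.Opens} {U : X.left.Opens}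
    (hle : U ≤ f.left ⁻¹ᵁ V) (c : ℂ) :
    SchemeOver.scalarRingHom X U c = f.left.appLE V U hle (SchemeOver.scalarRingHom Y V c) := by
  rw [SchemeOver.scalarRingHom_apply, SchemeOver.scalarRingHom_apply]
  have h1 : f.left.appLE V U hle (Y.hom.appLE ⊤ V le_top ((Scheme.ΓSpecIso (.of ℂ)).inv c)) =
      (Y.hom.appLE ⊤ V le_top ≫ f.left.appLE V U hle) ((Scheme.ΓSpecIso (.of ℂ)).inv c) := rfl
  rw [h1, Scheme.Hom.appLE_comp_appLE]
  have key : ∀ (g : X.left ⟶ Spec (.of ℂ)) (_ : g = X.hom) (e' : U ≤ g ⁻¹ᵁ ⊤),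
      g.appLE ⊤ U e' = X.hom.appLE ⊤ U le_top := by
    rintro _ rfl _; rfl
  rw [key _ (Over.w f)]

/-- Evaluation of a pulled-back function: `(f^* s)(P) = s(f(P))` for `s ∈ Γ(Y, V)`,
`P ∈ U(ℂ)`, `U ⊆ f⁻¹V` (`AlgPoints.eval_map` and restriction). [folklore] -/
theorem eval_appLE (f : X ⟶ Y) {V : Y.left.Opens} {U : X.left.Opens} (hle : U ≤ f.left ⁻¹ᵁ V)
    (P : ComplexPoints X) (hPU : P.pt ∈ U) (s : Γ(Y.left, V)) :
    P.eval U hPU (f.left.appLE V U hle s) = (AlgPoints.map f P).eval V (hle hPU) s := by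
  rw [AlgPoints.eval_map]
  exact AlgPoints.eval_map_homOfLE hle _ hPU

/-- Total evaluation of a pulled-back function on `U(ℂ)`: `evalOrZero U (f^* s) P = evalOrZero V s (f P)`
for `P ∈ U(ℂ)`. [folklore] -/
theorem evalOrZero_appLE (f : X ⟶ Y) {V : Y.left.Opens} {U : X.left.Opens} (hle : U ≤ f.left ⁻¹ᵁ V)
    (P : ComplexPoints X) (hPU : P.pt ∈ U) (s : Γ(Y.left, V)) :
    evalOrZero U (f.left.appLE V U hle s) P = evalOrZero V s (AlgPoints.map f P) := by
  rw [evalOrZero_of_mem _ hPU, evalOrZero_of_mem _ (show (AlgPoints.map f P).pt ∈ V from hle hPU),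
    eval_appLE]

/-- **A smooth morphism is a submersion on complex points, in algebraic charts** (SGA1 XII
Prop. 3.1 (iv): `f` smooth ⇒ `f^an` smooth, i.e. a submersion of complex manifolds). Let
`f : X ⟶ Y` be a morphism of `ℂ`-schemes with `f` smooth; let `e_Y` be an algebraic chart of `Y(ℂ)`
at `Q = f(P)` with coordinates `u₁, …, u_m ∈ Γ(Y, V₁)` and `e_X` an algebraic chart of `X(ℂ)` at `P`
(regular coordinates, regular functions holomorphic); assume `X` has local coordinates
`t₁, …, tₙ` modulo `𝔪_P²` on an affine open `U ∋ P` with `U ⊆ f⁻¹V₁`. Then the chart expression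
`F = e_Y ∘ f(ℂ) ∘ e_X⁻¹ : ℂⁿ → ℂᵐ` is differentiable at `e_X P` with ONTO differential. Proof: for
`w ∈ ℂᵐ` the point derivation `a ↦ d(a ∘ e_Y⁻¹)(w)` of `Γ(Y, V₁)` at `Q` extends along the formally
smooth `f^* : Γ(Y, V₁) → Γ(X, U)` (`Literature.RingTheory.Smooth.exists_pointDerivation_comp_eq`) to a
point derivation at `P`, equal to `d(· ∘ e_X⁻¹)(v)` (`exists_eq_fderiv_chart_of_pointDerivation`);
on `a = f^* u_j` this reads `dF(v)_j = w_j`. [cite: SGA1, Exp. XII Prop. 3.1 (iv)] -/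
theorem surjective_fderiv_chart_map (f : X ⟶ Y) [Smooth f.left]
    (eX : OpenPartialHomeomorph (ComplexPoints X) (Fin n → ℂ)) {P : ComplexPoints X}
    (hP : P ∈ eX.source)
    (holX : ∀ (U : X.left.affineOpens) (s : Γ(X.left, ↑U)),
      ContDiffOn ℂ ω (evalOrZero ↑U s ∘ eX.symm)
        (eX.target ∩ eX.symm ⁻¹' {Q | Q.pt ∈ (↑U : X.left.Opens)}))
    (algX : ∃ (U₁ : X.left.affineOpens) (x : Fin n → Γ(X.left, ↑U₁)),
      eX.source ⊆ {Q | Q.pt ∈ (↑U₁ : X.left.Opens)} ∧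
        ∀ Q ∈ eX.source, ∀ i, eX Q i = evalOrZero ↑U₁ (x i) Q)
    (eY : OpenPartialHomeomorph (ComplexPoints Y) (Fin m → ℂ))
    (hQ : AlgPoints.map f P ∈ eY.source)
    (holY : ∀ (V : Y.left.affineOpens) (s : Γ(Y.left, ↑V)),
      ContDiffOn ℂ ω (evalOrZero ↑V s ∘ eY.symm)
        (eY.target ∩ eY.symm ⁻¹' {Q | Q.pt ∈ (↑V : Y.left.Opens)}))
    (V₁ : Y.left.affineOpens) (u : Fin m → Γ(Y.left, ↑V₁))
    (hsrcY : eY.source ⊆ {Q | Q.pt ∈ (↑V₁ : Y.left.Opens)})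
    (hu : ∀ Q ∈ eY.source, ∀ j, eY Q j = evalOrZero ↑V₁ (u j) Q)
    (U : X.left.affineOpens) (hPU : P.pt ∈ (↑U : X.left.Opens))
    (hle : (↑U : X.left.Opens) ≤ f.left ⁻¹ᵁ ↑V₁) (t : Fin n → Γ(X.left, ↑U))
    (htspan : ∀ a ∈ RingHom.ker (P.evalRingHom ↑U hPU), ∃ coef : Fin n → ℂ,
      a - ∑ i, SchemeOver.scalarRingHom X ↑U (coef i) * t i ∈
        RingHom.ker (P.evalRingHom ↑U hPU) ^ 2) :
    DifferentiableAt ℂ (eY ∘ AlgPoints.map f ∘ eX.symm) (eX P) ∧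
      Function.Surjective (fderiv ℂ (eY ∘ AlgPoints.map f ∘ eX.symm) (eX P)) := by
  classical
  set Q := AlgPoints.map f P with hQdef
  have hQV₁ : Q.pt ∈ (↑V₁ : Y.left.Opens) := hsrcY hQ
  -- the pulled-back coordinates `g_j = f^* u_j ∈ Γ(X, U)`
  set g : Fin m → Γ(X.left, ↑U) := fun j => f.left.appLE ↑V₁ ↑U hle (u j) with hg
  -- the components of the chart expression agree near `eX P` with the read-off of `g_j`
  set Fj : Fin m → (Fin n → ℂ) → ℂ := fun j z => eY (AlgPoints.map f (eX.symm z)) j with hFj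
  have hF : (eY ∘ AlgPoints.map f ∘ eX.symm : (Fin n → ℂ) → Fin m → ℂ) = fun z j => Fj j z := rfl
  have hnear : ∀ᶠ z in 𝓝 (eX P), AlgPoints.map f (eX.symm z) ∈ eY.source := by
    have hc : ContinuousAt (fun z => AlgPoints.map f (eX.symm z)) (eX P) :=
      (AlgPoints.continuous_map f).continuousAt.comp (eX.continuousAt_symm (eX.map_source hP))
    refine hc.preimage_mem_nhds ?_
    rw [eX.left_inv hP]
    exact eY.open_source.mem_nhds hQ
  have hFj_eq : ∀ j, Fj j =ᶠ[𝓝 (eX P)] (evalOrZero ↑U (g j) ∘ eX.symm) := fun j => by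
    filter_upwards [hnear, eventually_chart_mem eX hP hPU] with z hz hz'
    simp only [hFj, hg, Function.comp_apply]
    rw [hu _ hz j, evalOrZero_appLE f hle _ hz'.2]
  have hdiff : ∀ j, DifferentiableAt ℂ (Fj j) (eX P) := fun j =>
    (differentiableAt_chart eX hP holX U hPU (g j)).congr_of_eventuallyEq (hFj_eq j)
  have hfd : ∀ j, fderiv ℂ (Fj j) (eX P) = fderiv ℂ (evalOrZero ↑U (g j) ∘ eX.symm) (eX P) :=
    fun j => (hFj_eq j).fderiv_eq
  refine ⟨by rw [hF]; exact differentiableAt_pi.2 hdiff, fun w => ?_⟩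
  -- the point derivation `a ↦ d(a ∘ e_Y⁻¹)(w)` of `Γ(Y, V₁)` at `Q`
  set κY := SchemeOver.scalarRingHom Y (↑V₁ : Y.left.Opens) with hκY
  let D : Γ(Y.left, ↑V₁) →+ ℂ :=
    { toFun := fun a => fderiv ℂ (evalOrZero ↑V₁ a ∘ eY.symm) (eY Q) w
      map_zero' := by
        rw [← map_zero κY, hκY, fderiv_chart_scalarRingHom eY hQ V₁ hQV₁]
        rfl
      map_add' := fun a b => by
        rw [fderiv_chart_add eY hQ holY V₁ hQV₁]
        rfl }
  have hDa : ∀ a, D a = fderiv ℂ (evalOrZero ↑V₁ a ∘ eY.symm) (eY Q) w := fun a => rfl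
  -- the formally smooth comorphism `Γ(Y, V₁) → Γ(X, U)` and the evaluations
  set φ : Γ(Y.left, ↑V₁) →+* Γ(X.left, ↑U) := (f.left.appLE ↑V₁ ↑U hle).hom with hφ
  have hφsm : φ.FormallySmooth := (f.left.smooth_appLE V₁.2 U.2 hle).formallySmooth
  have hcompat : ∀ a, P.eval ↑U hPU (φ a) = Q.eval ↑V₁ hQV₁ a := fun a => eval_appLE f hle P hPU a
  have hDmul : ∀ a b, D (a * b) = (P.evalRingHom ↑U hPU) (φ a) * D b +
      (P.evalRingHom ↑U hPU) (φ b) * D a := fun a b => by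
    rw [AlgPoints.evalRingHom_apply, AlgPoints.evalRingHom_apply, hcompat, hcompat, hDa, hDa, hDa,
      fderiv_chart_mul eY hQ holY V₁ hQV₁]
    simp
  -- extend it to a point derivation of `Γ(X, U)` at `P`
  obtain ⟨D', hD'mul, hD'φ⟩ :=
    Literature.RingTheory.Smooth.exists_pointDerivation_comp_eq hφsm (P.evalRingHom ↑U hPU) D hDmul
  have hD'mul' : ∀ a b, D' (a * b) = P.eval ↑U hPU a * D' b + P.eval ↑U hPU b * D' a :=
    fun a b => by rw [hD'mul, AlgPoints.evalRingHom_apply, AlgPoints.evalRingHom_apply]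
  have hD'c : ∀ c : ℂ, D' (SchemeOver.scalarRingHom X ↑U c) = 0 := fun c => by
    rw [scalarRingHom_eq_appLE f hle c]
    change D' (φ (κY c)) = 0
    rw [hD'φ, hDa, hκY, fderiv_chart_scalarRingHom eY hQ V₁ hQV₁]
    rfl
  -- which is a tangent vector `v`
  obtain ⟨v, hv⟩ :=
    exists_eq_fderiv_chart_of_pointDerivation eX hP holX U hPU t htspan algX D' hD'mul' hD'c
  refine ⟨v, ?_⟩
  rw [hF, fderiv_pi hdiff]
  funext j
  rw [ContinuousLinearMap.pi_apply, hfd j, ← hv (g j)]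
  change D' (φ (u j)) = w j
  rw [hD'φ, hDa, fderiv_chart_coord eY hQ V₁ u hu j]
  rfl

end Literature.AlgebraicGeometry.Motives

end
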